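import Summits.CriticalPhenomena.PercolationContinuityZ3.Theorems.Transplant.SkelPhiConcReachCorrR
import Summits.CriticalPhenomena.PercolationContinuityZ3.Theorems.Transplant.SkelSign2ParamsCorr
import HarnessLib

/-!
# Residue (C) of route D″ v2 AT THE CHOICE FUNCTION OF RECORD: `PlanarSkeletonSign.reachHoldsRHFn_signChoice₂ : ReachHoldsRHFn signChoice₂`
# — the run-restricted habitat corridor residue `Skel.ReachOblRH` of the chosen two-unit scheme at every running density `q` with `AtQ`, as
# ONE call of `Skelφ.reachOblRH_of_stepI_corrR` (SkelPhiConcReachCorrR, p254079) fed by stmt-g9's parameter ledger (`SkelSign1Params2` (`signChoice₂`, the choice function of record),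
# `SkelSign2ParamsAtQ/AtQ2/Depth/Counts/Corr`: the corridor values `Sgn₂.L₁₀ … ρC`, `corr_loc₁_at/…/corr_joins_at` (`Corr.CorrROK`), the rooms
# `corr_rooms₁_at/corr_rooms₂_at`, the merged-range route facts `corr_route_at/corr_range_at/corr_widths_merged_at/hdepth_range_at`, the
# depth budget `r₀_add_three_le_Lp`, the kit block of `Skelφ.Prm`, the counts `counts_at_le/hN/levels_card`, the fibre facts `fibre_at/E₀_at`, the
# excess `hRex_at_le`, the Step-I′ family `inputs_at_sq` at threshold `1 − κ.δ²`)

builds on p205010 (kernel theorem, internal audit signed; external expert review pending) — nothing in this file uses p205010.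
Lane `prim-bschramm`, seat `prim-bschramm-p5` (gen 6; (C) column of the D″ order of battle — its last file), helper file
(`--supports stmt-CriticalPhenomena-4575 --as helper`).  Division of labour stmt-g9 06:59:34Z / 07:17:25Z / 07:26:30Z (₂ of record): values + facts theirs, the one call mine.
* **`PlanarSkeletonSign.reachHoldsRHFn_signChoice₂`** — the (C) argument of `samePDropOfSkeletonSign₁_of_choiceFnRH signChoice₂ …`.
[cite: KozmaNitzan2024, §4 Lemma 12 (pp. 23–25), p. 30 (Step IV), p. 31]
-/

noncomputable section

open scoped Classical

namespace Summit.CriticalPhenomena.PercolationContinuityZ3.Theorems.Transplant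

namespace PlanarSkeletonSign

open MeasureTheory
open Literature.Probability.Percolation Literature.Probability.LatticeModels SimpleGraph
open Literature.Probability.Percolation.KozmaNitzan.Cells (oth oth_oth)
open SkelConc (Consts)
open ChainPlanar KNCells

/-- **THE (C) RESIDUE AT THE CHOICE FUNCTION OF RECORD**: for every handed constants `κ`, every admissible centred one-type sign skeleton and
every running density with `AtQ`, the run-restricted habitat corridor obligations `Skel.ReachOblRH` of the chosen scheme hold at accuracy `κ.δ`.
[cite: KozmaNitzan2024, §4 Lemma 12 (pp. 23–25), p. 30 (Step IV), p. 31] -/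
theorem reachHoldsRHFn_signChoice₂ : ReachHoldsRHFn signChoice₂ := by
  intro κ V _ _ G _ Φ hg t ht h1 h0 p hp0 hp1 hC O q hat
  change (Sgn₂.choiceAt κ Φ t p hC).AtQ O q at hat
  -- the chosen scheme is the two-unit scheme of record over `Sgn₂.cells` with the radii `concRadii2S cells gap 0 E₀ L′` (all by `rfl`)
  show Skel.ReachOblRH G
    (⟨Skelφ.cellGeomSG G Φ.φ (Sgn₂.cells κ Φ p O) t (Skelφ.concRadii2S (Sgn₂.cells κ Φ p O) (Skelφ.Prm.gap (Sgn₂.schedIn κ Φ p O q))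
      (fun _ => 0) (Skelφ.Prm.E₀ (Sgn₂.schedIn κ Φ p O q)) (Skelφ.Prm.Lp (Sgn₂.schedIn κ Φ p O q))), q, κ.δ⟩ : KSchA V ℕ)
    (Skelφ.faceDataSG G Φ.φ (Sgn₂.cells κ Φ p O) t (Skelφ.concRadii2S (Sgn₂.cells κ Φ p O) (Skelφ.Prm.gap (Sgn₂.schedIn κ Φ p O q))
      (fun _ => 0) (Skelφ.Prm.E₀ (Sgn₂.schedIn κ Φ p O q)) (Skelφ.Prm.Lp (Sgn₂.schedIn κ Φ p O q)))) Φ.Δ κ.δ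
  -- the dictionary of the sign skeleton
  have hlip : Skelφ.Lip G Φ.φ := Φ.toPlanarSkeletonNeg.lip_skelφ
  have hstep : Skelφ.Steps G Φ.φ := Φ.toPlanarSkeletonNeg.steps_skelφ
  have hκ : Skelφ.CylConn G Φ.φ Φ.types := Φ.toPlanarSkeletonNeg.cylConn_skelφ
  -- the Step-I′ family at `q` with threshold `1 − κ.δ²`, over the lists of record (index set at the one type `t`)
  have hδk : Sgn.δkit κ Φ ≤ κ.δ := (Sgn₂.δkit_facts κ Φ).2.2.1
  have hfam : ∀ i ∈ Skelφ.StepI.index Φ.types (Sgn.Sz O) (Sgn₂.Sx κ Φ p O) (Sgn₂.Sy κ Φ p O),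
      1 - κ.δ ^ 2 < (bondPercolation G q).real (Skelφ.StepI.event G Φ.φ O.D i) := by
    rw [h1]; exact Sgn₂.inputs_at_sq hat hδk
  -- the kit scale and the level window
  obtain ⟨-, -, hR', -⟩ := Sgn₂.kit_scale_at (κ := κ) (Φ := Φ) (p := p) (O := O)
  obtain ⟨hcard, hj₁⟩ := Sgn₂.levels_card (κ := κ) (Φ := Φ) (O := O) hp0 hp1
  obtain ⟨hkP, hcnt⟩ := Sgn₂.counts_at_le hat hp0 hp1 hδk
  obtain ⟨hNP, -⟩ := Sgn₂.hN (κ := κ) (Φ := Φ) (O := O) hp0 hp1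
  obtain ⟨hr₀₁, hr₀₂, -⟩ := Sgn₂.r₀_kit_at (κ := κ) (Φ := Φ) (p := p) (O := O)
  have hRΛ := Sgn₂.R_Λ_eq hat
  refine Skelφ.reachOblRH_of_stepI_corrR (types := Φ.types) hlip hstep Φ.frame hκ Φ.degree_le hC (D := O.D) (off := O.off) hRΛ.2 q κ.hδ0
    hfam (Sgn₂.cells κ Φ p O) t (Skelφ.Prm.gap (Sgn₂.schedIn κ Φ p O q)) (fun _ => 0) (Skelφ.Prm.E₀ (Sgn₂.schedIn κ Φ p O q))
    (Skelφ.Prm.Lp (Sgn₂.schedIn κ Φ p O q)) κ.δ (R' := Sgn.R' κ Φ p O) (Rlev := Sgn.Rlev κ Φ p O) (N := Sgn.NP κ Φ p O) (j₀ := Sgn.T₀ O)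
    (j₁ := Sgn.T₀ O + Sgn.Lcnt κ Φ p O - 1) (le_of_eq hR'.symm) hj₁ Sgn₂.WFS2_at h0 (fun n => (Sgn₂.fibre_at (κ := κ) (Φ := Φ) (p := p) (O := O) (q := q) n 0).2.2.1) ?_
    (fun ρ => (Sgn₂.fibre_at (κ := κ) (Φ := Φ) (p := p) (O := O) (q := q) ρ 0).2.1)
    -- the corridor schedules per axis
    (fun a => ⟨Sgn₂.corr_loc₁_at hat a, Sgn₂.corr_loc₂_at hat a, Sgn₂.corr_band_at hat a, Sgn₂.corr_hℓ₁₃_at hat a,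
      (Sgn₂.corr_joins_at (κ := κ) (Φ := Φ) (p := p) (O := O) a).1, (Sgn₂.corr_joins_at (κ := κ) (Φ := Φ) (p := p) (O := O) a).2.1,
      (Sgn₂.corr_joins_at (κ := κ) (Φ := Φ) (p := p) (O := O) a).2.2.1, (Sgn₂.corr_joins_at (κ := κ) (Φ := Φ) (p := p) (O := O) a).2.2.2⟩)
    (fun a => (Sgn₂.corr_rooms₁_at hat a).1) (fun a => (Sgn₂.corr_rooms₁_at hat a).2.1)
    (fun a => (Sgn₂.corr_rooms₂_at hat a).1) (fun a => (Sgn₂.corr_rooms₂_at hat a).2.1) (fun a => (Sgn₂.corr_rooms₂_at hat a).2.2.1)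
    (fun a => (Sgn₂.corr_rooms₂_at hat a).2.2.2.1) (fun a => (Sgn₂.corr_rooms₁_at hat a).2.2.1) (fun a => (Sgn₂.corr_rooms₂_at hat a).2.2.2.2.1)
    (fun a => (Sgn₂.corr_rooms₁_at hat a).2.2.2.2) (fun a => (Sgn₂.corr_rooms₁_at hat a).2.2.2.1) (fun a => (Sgn₂.corr_rooms₂_at hat a).2.2.2.2.2)
    (fun a => Sgn₂.corridor_length_le hat a)
    -- the count and the excess
    (η := Sgn.η κ Φ) ?_ (Sgn₂.η_facts κ Φ).2.2.1 (Rex := Sgn₂.Rex κ Φ p O q) ?_ ?_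
    -- the kit
    (Mz := Sgn.Mu O) (Sgn₂.mem_lists_at (κ := κ) (Φ := Φ) (p := p) (O := O)).1 (Sgn₂.Mu_facts hat).2.2.2 (ℓK := Skelφ.Prm.ℓK (Sgn.Mu O))
    (fun I _ => (Sgn₂.mem_lists_at (κ := κ) (Φ := Φ) (p := p) (O := O)).2.1) (fun I _ => (Sgn₂.mem_lists_at (κ := κ) (Φ := Φ) (p := p) (O := O)).2.2.1)
    (A := Skelφ.Prm.A O.D (Sgn.Mu O)) (Rk := Skelφ.Prm.Rk O.D (Sgn.Mu O)) (Skelφ.Prm.hAw O.D (Sgn.Mu O)) (Skelφ.Prm.hRk O.D (Sgn.Mu O))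
    (ℓs := Sgn.M O) (M := Sgn.M O) (K := Sgn.Kd O) (R'k := Sgn.Rseed Φ O) (r₀ := Sgn₂.r₀ κ Φ p O) (rs := Sgn.rs Φ O)
    (Skelφ.Prm.one_le_M O.D (Sgn.Mu O)) le_rfl (Skelφ.Prm.hA O.D (Sgn.Mu O)) (Skelφ.Prm.hAℓ O.D (Sgn.Mu O))
    (Skelφ.Prm.hK O.D (Sgn.Mu O) (Sgn.ρz O)) (Skelφ.Prm.hnA O.D (Sgn.Mu O)) (Skelφ.Prm.hnM O.D (Sgn.Mu O)) ?_
    (Skelφ.Prm.hR'₁ O.D (Sgn.Mu O) G Φ.φ Φ.types) (Skelφ.Prm.hR'₂ O.D (Sgn.Mu O) G Φ.φ Φ.types) hr₀₁ hr₀₂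
    (Skelφ.Prm.hrs₁ O.D (Sgn.Mu O) G Φ.φ Φ.types (Sgn.ρz O)) (Skelφ.Prm.hrs₂ O.D (Sgn.Mu O) G Φ.φ Φ.types (Sgn.ρz O))
    (cU := Sgn.cU Φ O) (Skelφ.Prm.hcU O.D (Sgn.Mu O) Φ.Δ)
    -- the route rooms on the merged range
    (fun a => (Sgn₂.corr_route_at hat a).1)
    (fun a ℓ h₀ h₁ => ((Sgn₂.corr_route_at hat a).2.1 ℓ ((Sgn₂.corr_range_at hat a).1.trans h₀) (h₁.trans (Sgn₂.corr_range_at hat a).2.1)).1)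
    (fun a ℓ h₀ h₁ => ((Sgn₂.corr_route_at hat a).2.1 ℓ ((Sgn₂.corr_range_at hat a).1.trans h₀) (h₁.trans (Sgn₂.corr_range_at hat a).2.1)).2)
    (fun a a' I ℓ h₀ h₁ => Sgn₂.hdepth_range_at hat a' I ((Sgn₂.corr_range_at hat a).1.trans h₀) (h₁.trans (Sgn₂.corr_range_at hat a).2.1))
    (fun a ℓ h₀ _ => Sgn₂.corr_widths_merged_at hat (oth a) ((Sgn₂.corr_range_at hat a).2.2.trans ((Sgn₂.corr_range_at hat a).1.trans h₀)))
    (fun a ℓ h₀ _ => Sgn₂.corr_widths_merged_at hat a ((Sgn₂.corr_range_at hat a).2.2.trans ((Sgn₂.corr_range_at hat a).1.trans h₀)))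
    (fun a ℓ h₀ _ => Sgn₂.corr_widths_merged_at hat a ((Sgn₂.corr_range_at hat a).2.2.trans ((Sgn₂.corr_range_at hat a).1.trans h₀)))
    -- the depth budget and the kit number
    (Sgn₂.r₀_add_three_le_Lp hat) (Sgn₂.E₀_at hat).2.2 (Sgn.kP κ Φ p O) hNP hkP
  · -- `44·rmax + 3 ≤ E₀`
    have := (Sgn₂.E₀_at hat).1; omega
  · -- the count over the level window `[T₀, T₀ + Lcnt − 1]`
    rw [hcard]; exact hcnt _ le_rfl
  · -- the excess radius at planar diameter `50·rmax ≤ 60·rmax`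
    intro R₀' R₁ hR Rw D' A' hD hbox hA' hA
    exact Sgn₂.hRex_at_le hat R₀' (m := 50 * (Sgn₂.cells κ Φ p O).rmax) (by omega) le_rfl t R₁ hR Rw D' A' hD hbox hA' hA
  · -- the excess radius is synchronised with the radii
    intro g
    have := (Sgn₂.fibre_at (κ := κ) (Φ := Φ) (p := p) (O := O) (q := q) 0 g).2.2.2.2.1
    omega
  · -- the zone room of the kit: `ψ Mu + off = ρz`
    intro i
    have := Skelφ.Prm.hρK O.D (Sgn.Mu O) (Sgn.ρz O) i
    rw [← hRΛ.1]
    exact this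

end PlanarSkeletonSign

end Summit.CriticalPhenomena.PercolationContinuityZ3.Theorems.Transplant

end
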